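import Summits.AtomisticToContinuum.Crystallization.Theorems.FrustratedLawDichotomyLensFive
import Summits.AtomisticToContinuum.Crystallization.Theorems.FrustratedLawDichotomyEightCerts

/-!
# FrustratedLawDichotomy · crux `AperiodicFrustratedLawGap` (stmt-AtomisticToContinuum-27623) — `CapMatchCert θ Pat` FROM A 12-POINT
# SCALAR BOUND: «square diagonals of an admissible link are `≥ d₀`» (decomp-a2c, prover hand 2, gen 10)

The P-side certificate `CapMatchCert θ Pat` (p822220; the two half-caps of a square coincide) is a 14-point statement with disjunctive
clauses.  By the lens lemma (`FrustratedLawDichotomyLensFive.lens_five_false`, a perturbed Hales Lemma 7) it follows from a SCALAR bound on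
the 12-point link alone: if `m₁ ≠ m₂`, the diagonal pair `p a, p b` has the five common neighbours `0, p w₁, p w₂, m₁, m₂` in the distance
window `[1/(1+θ), (1+θ)²]`, pairwise `≥ 1/(1+θ)²` apart (all read off the coupled windows of `CapMatchCert`'s hypotheses), which is impossible
once `‖p a − p b‖ ≥ d₀` with `(5 − √5)/2 · ((1+θ)⁴ − d₀²/4) < (1+θ)⁻⁴ − (((1+θ)⁴ − (1+θ)⁻²)/d₀)²` — at `θ = 1/100`: any `d₀ ≥ 1.18`; we
register `d₀ = 6/5` (`0.9406 < 0.9585`).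

* `LinkDiagonalBound θ d₀ Pat` — the finite 12-point statement: every admissible link (`CapMatchCert`'s link hypotheses on the cluster
  `{0} ∪ range p`) has all square diagonals `‖p a − p b‖ ≥ d₀` (`dist a b = √2`).  [certificate target; the pyritohedral jitterbug at the
  window edge `t ≈ 1.22` has shortest diagonal `2/√(1 + t²) ≈ 1.268`; census: minimise the diagonal over the window set]
* ★ `capMatchCert_of_linkDiagonalBound` : `0 ≤ θ → 0 < d₀ →` (numerical condition) `→ LinkDiagonalBound θ d₀ Pat → CapMatchCert θ Pat`;
  `capMatchCert_of_linkDiagonalBound_hundredth` : `LinkDiagonalBound (1/100) (6/5) Pat → CapMatchCert (1/100) Pat`;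
* by name, with the five-certificate P (p823174): `capForcing_of_noTwist_of_diagonalBounds`, `kr2Shape_of_certs_of_diagonalBounds`,
  `aperiodicFrustratedLawGap_of_certs_of_diagonalBounds` — the P-side of the FLD column is now THREE two-link «no twist» statements and TWO
  scalar diagonal bounds.
`[folklore]` bookkeeping; one definition (the certificate statement); no `sorry`; no `instance`/`notation`.
-/

noncomputable section

namespace Summit.AtomisticToContinuum.Crystallization.Theorems.FrustratedLawDichotomyCapMatchOfDiagonal

open Literature.Geometry.DiscreteGeometry
open Summit.AtomisticToContinuum.Crystallization.Theses.PricedLinkCensus (ChargedEnergyGap)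
open Summit.AtomisticToContinuum.Crystallization.Theorems.FrustratedLawDichotomyTwoShellRigidityCut
  (E3 CapForcing KR2Shape kr2Shape_of_cut aperiodicFrustratedLawGap_of_cut noFrustratedPeriodicMinimiser_of_cut)
open Summit.AtomisticToContinuum.Crystallization.Theorems.FrustratedLawDichotomyCappedRigidityCert (CappedCert)
open Summit.AtomisticToContinuum.Crystallization.Theorems.FrustratedLawDichotomyCappedRigidityCertPatterns (cappedRigidity_of_cert)
open Summit.AtomisticToContinuum.Crystallization.Theorems.FrustratedLawDichotomyLinkCert (LinkCert linkClassification_of_linkCert)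
open Summit.AtomisticToContinuum.Crystallization.Theorems.FrustratedLawDichotomyNoTwistCert (BondLike NoTwistCert)
open Summit.AtomisticToContinuum.Crystallization.Theorems.FrustratedLawDichotomyCapMatchCert (CapMatchCert)
open Summit.AtomisticToContinuum.Crystallization.Theorems.FrustratedLawDichotomyEightCerts (capForcing_of_fiveCerts)
open Summit.AtomisticToContinuum.Crystallization.Theorems.FrustratedLawDichotomyLensFive (lens_five_false)

/-- **`LinkDiagonalBound θ d₀ Pat` — square diagonals of an admissible link are at least `d₀`.**  For every `p : Pat → ℝ³` with radial
window `1 ≤ ‖p u‖ ≤ 1 + θ`, injective, coupled windows for the centre's bonds and the pattern contacts on the cluster `{0} ∪ range p`, and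
non-bond strictness for the pattern non-contacts: `dist a b = √2 ⟹ d₀ ≤ ‖p a − p b‖`. [certificate target; 12 points, one scalar] -/
def LinkDiagonalBound (θ d₀ : ℝ) (Pat : Finset E3) : Prop :=
  ∀ p : ↥Pat → E3,
    (∀ u : ↥Pat, 1 ≤ ‖p u‖ ∧ ‖p u‖ ≤ 1 + θ) → Function.Injective p →
    (∀ u : ↥Pat, BondLike θ (insert 0 (Set.range p)) 0 (p u)) →
    (∀ u v : ↥Pat, dist (u : E3) (v : E3) = 1 → BondLike θ (insert 0 (Set.range p)) (p u) (p v)) →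
    (∀ u v : ↥Pat, u ≠ v → dist (u : E3) (v : E3) ≠ 1 → min ‖p u‖ ‖p v‖ < ‖p u - p v‖) →
    ∀ a b : ↥Pat, dist (a : E3) (b : E3) = Real.sqrt 2 → d₀ ≤ ‖p a - p b‖

/-- `BondLike` is antitone in the cluster. [folklore] -/
theorem bondLike_mono {θ : ℝ} {K K' : Set E3} {X Y : E3} (hK : K' ⊆ K) (h : BondLike θ K X Y) : BondLike θ K' X Y :=
  ⟨fun Z hZ hne => h.1 Z (hK hZ) hne, fun Z hZ hne => h.2 Z (hK hZ) hne⟩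

/-- Pairwise separation of five points from the ten ordered facts `i < j`. [folklore] -/
theorem sep_of_lt {s : ℝ} {P : Fin 5 → E3} (h : ∀ i j : Fin 5, i < j → s ≤ dist (P i) (P j)) :
    ∀ i j : Fin 5, i ≠ j → s ≤ dist (P i) (P j) := by
  intro i j hij
  rcases lt_or_gt_of_ne hij with hlt | hlt
  · exact h i j hlt
  · rw [dist_comm]; exact h j i hlt

/-- ★ **`CapMatchCert θ Pat` from the diagonal bound.** [folklore] -/
theorem capMatchCert_of_linkDiagonalBound {θ d₀ : ℝ} {Pat : Finset E3} (hθ : 0 ≤ θ) (hd₀ : 0 < d₀)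
    (hnum : (5 - Real.sqrt 5) / 2 * (((1 + θ) ^ 2) ^ 2 - d₀ ^ 2 / 4) <
      ((1 + θ)⁻¹ ^ 2) ^ 2 - ((((1 + θ) ^ 2) ^ 2 - (1 + θ)⁻¹ ^ 2) / d₀) ^ 2)
    (hD : LinkDiagonalBound θ d₀ Pat) : CapMatchCert θ Pat := by
  intro p a b w₁ w₂ m₁ m₂ hab haw₁ hbw₁ haw₂ hbw₂ hw12 hrad hinj hB0 hBc hS hm₁r hm₂r hm₁0 hm₂0 hm₁a hm₁b hm₁w₁ hm₂a hm₂b hm₂w₂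
    _ _ _ _ _
  by_contra hne
  set lam : ℝ := 1 + θ with hlam
  have hlam1 : 1 ≤ lam := by rw [hlam]; linarith
  have hlam0 : 0 < lam := by linarith
  set K : Set E3 := insert 0 (Set.range p ∪ {m₁, m₂}) with hK
  -- membership facts
  have h0K : (0 : E3) ∈ K := Set.mem_insert _ _
  have hpK : ∀ u, p u ∈ K := fun u => Set.mem_insert_of_mem _ (Or.inl ⟨u, rfl⟩)
  have hm₁K : m₁ ∈ K := Set.mem_insert_of_mem _ (Or.inr (by simp))
  have hm₂K : m₂ ∈ K := Set.mem_insert_of_mem _ (Or.inr (by simp))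
  have hp0 : ∀ u, p u ≠ 0 := fun u h => by have := (hrad u).1; rw [h, norm_zero] at this; linarith
  have hm₁p : ∀ u, m₁ ≠ p u := fun u h => hm₁r ⟨u, h.symm⟩
  have hm₂p : ∀ u, m₂ ≠ p u := fun u h => hm₂r ⟨u, h.symm⟩
  -- (F1) every cluster point other than 0 has norm ≥ ‖p u‖/λ ≥ 1/λ;  (F2) every cluster point Z ≠ p u is at distance ≥ ‖p u‖/λ from p u
  have F1 : ∀ Z ∈ K, Z ≠ 0 → lam⁻¹ ≤ ‖Z‖ := by
    intro Z hZ hne0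
    have h := (hB0 a).1 Z hZ hne0
    rw [zero_sub, norm_neg, zero_sub, norm_neg] at h
    rw [inv_le_iff_one_le_mul₀ hlam0]
    nlinarith [(hrad a).1]
  have F2 : ∀ u, ∀ Z ∈ K, Z ≠ p u → lam⁻¹ ≤ ‖p u - Z‖ := by
    intro u Z hZ hneu
    have h := (hB0 u).2 Z hZ hneu
    rw [zero_sub, norm_neg] at h
    rw [inv_le_iff_one_le_mul₀ hlam0]
    nlinarith [(hrad u).1]
  -- upper bounds: contacts and cap bonds are ≤ λ²
  have U1 : ∀ u v, BondLike θ K (p u) (p v) → ‖p u - p v‖ ≤ lam ^ 2 := by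
    intro u v h
    have h1 := h.1 0 h0K (hp0 u).symm
    rw [sub_zero] at h1
    nlinarith [(hrad u).2, (hrad u).1]
  have U2 : ∀ (m : E3) u, BondLike θ K m (p u) → ‖m - p u‖ ≤ lam ^ 2 := by
    intro m u h
    have h1 := h.2 0 h0K (hp0 u).symm
    rw [sub_zero] at h1
    nlinarith [(hrad u).2, (hrad u).1]
  -- the diagonal
  have hdiag : d₀ ≤ dist (p a) (p b) := by
    rw [dist_eq_norm]
    have hsub : insert 0 (Set.range p) ⊆ K := by
      intro Z hZ
      rcases hZ with rfl | hZ
      · exact h0K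
      · exact Set.mem_insert_of_mem _ (Or.inl hZ)
    exact hD p hrad hinj (fun u => bondLike_mono hsub (hB0 u)) (fun u v h => bondLike_mono hsub (hBc u v h)) hS a b hab
  -- window facts: `lo ≤ dist X c ^ 2 ≤ hi` from `1/λ ≤ dist X c ≤ λ²`
  have win : ∀ {X c : E3}, lam⁻¹ ≤ dist X c → dist X c ≤ lam ^ 2 →
      lam⁻¹ ^ 2 ≤ dist X c ^ 2 ∧ dist X c ^ 2 ≤ (lam ^ 2) ^ 2 := fun h1 h2 =>
    ⟨pow_le_pow_left₀ (inv_nonneg.2 hlam0.le) h1 2, pow_le_pow_left₀ dist_nonneg h2 2⟩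
  have hlaminv1 : lam⁻¹ ≤ 1 := inv_le_one_of_one_le₀ hlam1
  have hlamsq : lam ≤ lam ^ 2 := by nlinarith
  -- distances to a link point c = p a or p b
  have toLink : ∀ c : ↥Pat, dist (a : E3) (c : E3) = 1 ∨ dist (b : E3) (c : E3) = 1 ∨ True →
      (lam⁻¹ ≤ dist (0 : E3) (p c) ∧ dist (0 : E3) (p c) ≤ lam ^ 2) := by
    intro c _
    rw [dist_comm, dist_eq_norm, sub_zero]
    exact ⟨hlaminv1.trans (hrad c).1, (hrad c).2.trans hlamsq⟩
  have linkLink : ∀ u c : ↥Pat, dist (c : E3) (u : E3) = 1 → lam⁻¹ ≤ dist (p u) (p c) ∧ dist (p u) (p c) ≤ lam ^ 2 := by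
    intro u c hcu
    have hne' : p c ≠ p u := fun h => by
      have := hinj h; rw [this, dist_self] at hcu; exact one_ne_zero hcu.symm
    rw [dist_eq_norm]
    refine ⟨F2 u (p c) (hpK c) hne', ?_⟩
    rw [norm_sub_rev]
    exact U1 c u (hBc c u hcu)
  have capLink : ∀ (m : E3) (c : ↥Pat), m ∈ K → m ∉ Set.range p → BondLike θ K m (p c) →
      lam⁻¹ ≤ dist m (p c) ∧ dist m (p c) ≤ lam ^ 2 := by
    intro m c hmK hmr h
    rw [dist_eq_norm]
    refine ⟨?_, U2 m c h⟩
    rw [norm_sub_rev]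
    exact F2 c m hmK (fun e => hmr ⟨c, e.symm⟩)
  -- the five points
  let P : Fin 5 → E3 := ![0, p w₁, p w₂, m₁, m₂]
  refine lens_five_false (A := p a) (B := p b) (P := P) (d₀ := d₀) (lo := lam⁻¹ ^ 2) (hi := (lam ^ 2) ^ 2)
    (s := lam⁻¹ ^ 2) hd₀ hdiag ?_ ?_ (by positivity) (sep_of_lt ?_) hnum
  · -- distances to p a
    have q0 := toLink a (Or.inr (Or.inr trivial))
    have q1 := linkLink a w₁ (by rw [dist_comm]; exact haw₁)
    have q2 := linkLink a w₂ (by rw [dist_comm]; exact haw₂)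
    have q3 := capLink m₁ a hm₁K hm₁r hm₁a
    have q4 := capLink m₂ a hm₂K hm₂r hm₂a
    intro k
    fin_cases k
    · simpa [P] using win q0.1 q0.2
    · simpa [P, dist_comm] using win q1.1 q1.2
    · simpa [P, dist_comm] using win q2.1 q2.2
    · simpa [P] using win q3.1 q3.2
    · simpa [P] using win q4.1 q4.2
  · -- distances to p b
    have q0 := toLink b (Or.inr (Or.inr trivial))
    have q1 := linkLink b w₁ (by rw [dist_comm]; exact hbw₁)
    have q2 := linkLink b w₂ (by rw [dist_comm]; exact hbw₂)
    have q3 := capLink m₁ b hm₁K hm₁r hm₁b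
    have q4 := capLink m₂ b hm₂K hm₂r hm₂b
    intro k
    fin_cases k
    · simpa [P] using win q0.1 q0.2
    · simpa [P, dist_comm] using win q1.1 q1.2
    · simpa [P, dist_comm] using win q2.1 q2.2
    · simpa [P] using win q3.1 q3.2
    · simpa [P] using win q4.1 q4.2
  · -- pairwise separations ≥ 1/λ² (we prove ≥ 1/λ ≥ 1/λ² for all but m₁–m₂)
    have hs1 : lam⁻¹ ^ 2 ≤ lam⁻¹ := by nlinarith [inv_nonneg.2 hlam0.le]
    have d01 : lam⁻¹ ^ 2 ≤ dist (0 : E3) (p w₁) := by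
      rw [dist_comm, dist_eq_norm, sub_zero]; exact hs1.trans (hlaminv1.trans (hrad w₁).1)
    have d02 : lam⁻¹ ^ 2 ≤ dist (0 : E3) (p w₂) := by
      rw [dist_comm, dist_eq_norm, sub_zero]; exact hs1.trans (hlaminv1.trans (hrad w₂).1)
    have d03 : lam⁻¹ ^ 2 ≤ dist (0 : E3) m₁ := by
      rw [dist_comm, dist_eq_norm, sub_zero]; exact hs1.trans (F1 m₁ hm₁K hm₁0)
    have d04 : lam⁻¹ ^ 2 ≤ dist (0 : E3) m₂ := by
      rw [dist_comm, dist_eq_norm, sub_zero]; exact hs1.trans (F1 m₂ hm₂K hm₂0)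
    have d12 : lam⁻¹ ^ 2 ≤ dist (p w₁) (p w₂) := by
      rw [dist_eq_norm]; exact hs1.trans (F2 w₁ (p w₂) (hpK w₂) (fun h => hw12 (hinj h).symm))
    have d13 : lam⁻¹ ^ 2 ≤ dist (p w₁) m₁ := by
      rw [dist_eq_norm]; exact hs1.trans (F2 w₁ m₁ hm₁K (hm₁p w₁))
    have d14 : lam⁻¹ ^ 2 ≤ dist (p w₁) m₂ := by
      rw [dist_eq_norm]; exact hs1.trans (F2 w₁ m₂ hm₂K (hm₂p w₁))
    have d23 : lam⁻¹ ^ 2 ≤ dist (p w₂) m₁ := by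
      rw [dist_eq_norm]; exact hs1.trans (F2 w₂ m₁ hm₁K (hm₁p w₂))
    have d24 : lam⁻¹ ^ 2 ≤ dist (p w₂) m₂ := by
      rw [dist_eq_norm]; exact hs1.trans (F2 w₂ m₂ hm₂K (hm₂p w₂))
    have d34 : lam⁻¹ ^ 2 ≤ dist m₁ m₂ := by
      -- ‖m₁ − p a‖ ≤ λ ‖m₁ − m₂‖ and ‖m₁ − p a‖ ≥ 1/λ
      have h1 : ‖m₁ - p a‖ ≤ lam * ‖m₁ - m₂‖ := hm₁a.1 m₂ hm₂K (fun h => hne h.symm)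
      have h2 : lam⁻¹ ≤ ‖m₁ - p a‖ := by rw [norm_sub_rev]; exact F2 a m₁ hm₁K (hm₁p a)
      have h3 : lam⁻¹ ≤ lam * ‖m₁ - m₂‖ := h2.trans h1
      rw [dist_eq_norm]
      calc lam⁻¹ ^ 2 = lam⁻¹ * lam⁻¹ := sq _
        _ ≤ lam⁻¹ * (lam * ‖m₁ - m₂‖) := mul_le_mul_of_nonneg_left h3 (inv_nonneg.2 hlam0.le)
        _ = ‖m₁ - m₂‖ := by rw [← mul_assoc, inv_mul_cancel₀ hlam0.ne', one_mul]
    intro i j hij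
    fin_cases i <;> fin_cases j <;> simp at hij
    · simpa [P] using d01
    · simpa [P] using d02
    · simpa [P] using d03
    · simpa [P] using d04
    · simpa [P] using d12
    · simpa [P] using d13
    · simpa [P] using d14
    · simpa [P] using d23
    · simpa [P] using d24
    · simpa [P] using d34

/-! ### The registered literal `θ = 1/100` with `d₀ = 6/5`, and the column by name -/

/-- **The numerical condition at `θ = 1/100`, `d₀ = 6/5`**: `(5 − √5)/2 · (1.01⁴ − 0.36) ≈ 0.9406 < 0.9585 ≈ 1.01⁻⁴ − ((1.01⁴ − 1.01⁻²)/1.2)²`.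
[folklore] -/
theorem num_hundredth_six_fifths :
    (5 - Real.sqrt 5) / 2 * (((1 + (1 / 100 : ℝ)) ^ 2) ^ 2 - (6 / 5 : ℝ) ^ 2 / 4) <
      ((1 + (1 / 100 : ℝ))⁻¹ ^ 2) ^ 2 - ((((1 + (1 / 100 : ℝ)) ^ 2) ^ 2 - (1 + (1 / 100 : ℝ))⁻¹ ^ 2) / (6 / 5 : ℝ)) ^ 2 := by
  have h5 : (2236 / 1000 : ℝ) < Real.sqrt 5 := by
    rw [show (2236 / 1000 : ℝ) = Real.sqrt ((2236 / 1000) ^ 2) by rw [Real.sqrt_sq]; norm_num]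
    exact Real.sqrt_lt_sqrt (by norm_num) (by norm_num)
  norm_num
  nlinarith [h5]

/-- ★ **`CapMatchCert (1/100) Pat` from `LinkDiagonalBound (1/100) (6/5) Pat`.** [folklore] -/
theorem capMatchCert_of_linkDiagonalBound_hundredth {Pat : Finset E3} (hD : LinkDiagonalBound (1 / 100) (6 / 5) Pat) :
    CapMatchCert (1 / 100) Pat :=
  capMatchCert_of_linkDiagonalBound (by norm_num) (by norm_num) num_hundredth_six_fifths hD

/-- **`CapForcing θ` from three «no twist» certificates and two diagonal bounds** (every `θ ≥ 0`, `d₀ > 0` satisfying the numerical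
condition). [folklore] -/
theorem capForcing_of_noTwist_of_diagonalBounds {θ d₀ : ℝ} (hθ : 0 ≤ θ) (hd₀ : 0 < d₀)
    (hnum : (5 - Real.sqrt 5) / 2 * (((1 + θ) ^ 2) ^ 2 - d₀ ^ 2 / 4) <
      ((1 + θ)⁻¹ ^ 2) ^ 2 - ((((1 + θ) ^ 2) ^ 2 - (1 + θ)⁻¹ ^ 2) / d₀) ^ 2)
    (hNff : NoTwistCert θ fccKissingPattern fccKissingPattern) (hNfh : NoTwistCert θ fccKissingPattern hcpKissingPattern)
    (hNhh : NoTwistCert θ hcpKissingPattern hcpKissingPattern)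
    (hDf : LinkDiagonalBound θ d₀ fccKissingPattern) (hDh : LinkDiagonalBound θ d₀ hcpKissingPattern) : CapForcing θ :=
  capForcing_of_fiveCerts hNff hNfh hNhh (capMatchCert_of_linkDiagonalBound hθ hd₀ hnum hDf)
    (capMatchCert_of_linkDiagonalBound hθ hd₀ hnum hDh)

/-- **`CapForcing (1/100)` from `NT(fcc,fcc), NT(fcc,hcp), NT(hcp,hcp)` at `1/100` and `LinkDiagonalBound (1/100) (6/5)` for fcc and hcp.**
[folklore] -/
theorem capForcing_hundredth_of_noTwist_of_diagonalBounds
    (hNff : NoTwistCert (1 / 100) fccKissingPattern fccKissingPattern) (hNfh : NoTwistCert (1 / 100) fccKissingPattern hcpKissingPattern)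
    (hNhh : NoTwistCert (1 / 100) hcpKissingPattern hcpKissingPattern)
    (hDf : LinkDiagonalBound (1 / 100) (6 / 5) fccKissingPattern) (hDh : LinkDiagonalBound (1 / 100) (6 / 5) hcpKissingPattern) :
    CapForcing (1 / 100) :=
  capForcing_of_fiveCerts hNff hNfh hNhh (capMatchCert_of_linkDiagonalBound_hundredth hDf)
    (capMatchCert_of_linkDiagonalBound_hundredth hDh)

/-- ★ **`KR2Shape` from `LinkCert(1/100)`, three «no twist» certificates, two diagonal bounds `LinkDiagonalBound (1/100) (6/5)`, and
`CappedCert (1/100, 1/20)` for fcc and hcp.** [folklore] -/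
theorem kr2Shape_of_certs_of_diagonalBounds (hG : LinkCert (1 / 100))
    (hNff : NoTwistCert (1 / 100) fccKissingPattern fccKissingPattern) (hNfh : NoTwistCert (1 / 100) fccKissingPattern hcpKissingPattern)
    (hNhh : NoTwistCert (1 / 100) hcpKissingPattern hcpKissingPattern)
    (hDf : LinkDiagonalBound (1 / 100) (6 / 5) fccKissingPattern) (hDh : LinkDiagonalBound (1 / 100) (6 / 5) hcpKissingPattern)
    (hMf : CappedCert (1 / 100) (1 / 20) fccKissingPattern) (hMh : CappedCert (1 / 100) (1 / 20) hcpKissingPattern) : KR2Shape :=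
  kr2Shape_of_cut (linkClassification_of_linkCert hG) (capForcing_hundredth_of_noTwist_of_diagonalBounds hNff hNfh hNhh hDf hDh)
    (cappedRigidity_of_cert hMf hMh)

/-- **`AperiodicFrustratedLawGap` (crux of item 27623) BY NAME** from `MuEquilibriumDoor ∧ ChargedEnergyGap`, `LinkCert (1/100)`, the three
«no twist» certificates, the two diagonal bounds and the two capped certificates. [folklore] -/
theorem aperiodicFrustratedLawGap_of_certs_of_diagonalBounds
    (hDoor : Summit.AtomisticToContinuum.Crystallization.Theses.GrainCoreNetworkSplit.MuEquilibriumDoor) (hgap : ChargedEnergyGap)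
    (hG : LinkCert (1 / 100))
    (hNff : NoTwistCert (1 / 100) fccKissingPattern fccKissingPattern) (hNfh : NoTwistCert (1 / 100) fccKissingPattern hcpKissingPattern)
    (hNhh : NoTwistCert (1 / 100) hcpKissingPattern hcpKissingPattern)
    (hDf : LinkDiagonalBound (1 / 100) (6 / 5) fccKissingPattern) (hDh : LinkDiagonalBound (1 / 100) (6 / 5) hcpKissingPattern)
    (hMf : CappedCert (1 / 100) (1 / 20) fccKissingPattern) (hMh : CappedCert (1 / 100) (1 / 20) hcpKissingPattern) :
    Summit.AtomisticToContinuum.Crystallization.Theses.FrustratedLawDichotomy.AperiodicFrustratedLawGap :=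
  aperiodicFrustratedLawGap_of_cut hDoor hgap (linkClassification_of_linkCert hG)
    (capForcing_hundredth_of_noTwist_of_diagonalBounds hNff hNfh hNhh hDf hDh) (cappedRigidity_of_cert hMf hMh)

/-- **Item 26654 `NoFrustratedPeriodicMinimiser`, door-free, from the same finite statements.** [folklore] -/
theorem noFrustratedPeriodicMinimiser_of_certs_of_diagonalBounds (hgap : ChargedEnergyGap) (hG : LinkCert (1 / 100))
    (hNff : NoTwistCert (1 / 100) fccKissingPattern fccKissingPattern) (hNfh : NoTwistCert (1 / 100) fccKissingPattern hcpKissingPattern)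
    (hNhh : NoTwistCert (1 / 100) hcpKissingPattern hcpKissingPattern)
    (hDf : LinkDiagonalBound (1 / 100) (6 / 5) fccKissingPattern) (hDh : LinkDiagonalBound (1 / 100) (6 / 5) hcpKissingPattern)
    (hMf : CappedCert (1 / 100) (1 / 20) fccKissingPattern) (hMh : CappedCert (1 / 100) (1 / 20) hcpKissingPattern) :
    Summit.AtomisticToContinuum.Crystallization.Theses.PeriodicChargeSplit.NoFrustratedPeriodicMinimiser :=
  noFrustratedPeriodicMinimiser_of_cut hgap (linkClassification_of_linkCert hG)
    (capForcing_hundredth_of_noTwist_of_diagonalBounds hNff hNfh hNhh hDf hDh) (cappedRigidity_of_cert hMf hMh)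

end Summit.AtomisticToContinuum.Crystallization.Theorems.FrustratedLawDichotomyCapMatchOfDiagonal

end
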